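import Mathlib
import Summits.ResolutionOfSingularities.ResolutionOfSingularities.Theorems.WeightedInvariantLocalWeightedDropNCTransversalGerms

/-!
# `LocalWeightedDrop`, line `nc-game-transport`, TOT rung R5 (part 1/2): BLOCKS OF VARIABLES — block embeddings, block extension of
# substitutions, the cobordant chart and the slice on a product of germs in disjoint blocks, the block swap

[OURS · L1 W4.3 · chain w43, engine crux `LocalWeightedDrop` stmt-ResolutionOfSingularities-8899; strategist res-L1-w43-strat-1, line
`nc-game-transport`, rung spec `TOT-RUNGS-SPEC.md` v2 §R5 `ProductClosure` (typed `NCTransport.Census.ProductClosure` in the strategist's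
`census_sketch.lean`); res-L1-w43-plan-1 RULING gen 9 #5 (3) to res-D-pv-006.  Objects = the programme's own count game (…SpaceCountGame);
NOT a statement of any manuscript; closes nothing by name.  Index bookkeeping only; the game is part 2/2 `…NCProductClosure`.]
Ambient `M + 1 = (m₁+1) + (m₂+1)` variables under a hypothesis `hM : m₁ + m₂ + 1 = M`, so that a block decomposition and its SWAP live in one
`Fin (M+1)`; phrased with Mathlib's `MvPowerSeries.rename` / `killCompl` (`rename_eq_subst` gives the census's `subst (fun i => X ⟨i, _⟩)`).
* `bL hM` (`i ↦ i`), `bR hM` (`j ↦ m₁+1+j`), `blockFun`, `blockEquiv`, `block_cases`, `prod_block`; one level up (chart variables `s = X 0`,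
  `y_l = X l.succ`) the shifted blocks are `bL (succ_hM hM)` / `bR (succ_hM hM)`: `bL_zero`, `bL_succ`, `bR_succ`, `predAbove_bL`,
  `predAbove_bL_bR` (the INDEX FACT: slicing at a LEFT slot keeps both blocks contiguous).
* `blockSubst hM Φ₁ Φ₂ = Φ₁ ⊗ Φ₂`: zero constant terms, block-diagonal linear part, `det = det Φ₁ · det Φ₂` (`det_linMat_blockSubst`);
  `subst_blockSubst_rename_bL/bR`; CHART with weights on the left block: `subst_chart_rename_bL` (left chart, shifted left block),
  `subst_chart_rename_bR` (re-indexing only); SLICE at a left slot: `slice_bL_rename_bL`, `slice_bL_rename_bR`; `s`-DIVISIBILITY via `killCompl`: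
  `X_dvd_of_X_dvd_rename_bL`, `eq_zero_of_X_dvd_rename_bR`; `blockSwap hM` (`blockSwap_bL/bR`, swapped decomposition `swap_hM hM`).
-/


noncomputable section

open Literature.AlgebraicGeometry.Resolution

set_option linter.dupNamespace false -- mandated namespace of this single-conjunct summit

namespace Summit.ResolutionOfSingularities.ResolutionOfSingularities.Theorems

namespace NCTransport

open MvPowerSeries TameFourTupleDrop

variable {k : Type} [Field k]

/-! ## Renaming and substitution -/

/-- Substituting into a renamed series: `a^*(rename ι F) = (a ∘ ι)^* F`. -/
theorem subst_rename_eq {σ τ υ : Type} [Finite σ] (ι : σ → τ) {a : τ → MvPowerSeries υ k} (ha : HasSubst a)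
    (F : MvPowerSeries σ k) : subst a (rename ι F) = subst (a ∘ ι) F := by
  rw [rename_eq_subst, subst_comp_subst_apply (HasSubst.X_comp ι) ha]
  congr 1
  funext t
  exact subst_X ha (ι t)

/-- Renaming a substituted series: `rename ι (a^* F) = (rename ι ∘ a)^* F`. -/
theorem rename_subst_eq {σ τ υ : Type} [Finite τ] (ι : τ → υ) {a : σ → MvPowerSeries τ k} (ha : HasSubst a)
    (F : MvPowerSeries σ k) : rename ι (subst a F) = subst (fun s => rename ι (a s)) F := by
  rw [rename_eq_subst, subst_comp_subst_apply ha (HasSubst.X_comp ι)]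
  congr 1
  funext s
  exact (rename_eq_subst ι (a s)).symm

/-! ## Blocks of variables -/

section Blocks

variable {m₁ m₂ M : ℕ}

/-- The LEFT BLOCK of indices: `i ↦ i` (`Fin (m₁+1) ↪ Fin (M+1)`, `M = m₁ + m₂ + 1`). -/
def bL (hM : m₁ + m₂ + 1 = M) : Fin (m₁ + 1) ↪ Fin (M + 1) :=
  ⟨fun i => ⟨i.val, by have := i.isLt; omega⟩, fun i j h => Fin.ext (by simpa using congrArg Fin.val h)⟩

/-- The RIGHT BLOCK of indices: `j ↦ m₁ + 1 + j` (`Fin (m₂+1) ↪ Fin (M+1)`, `M = m₁ + m₂ + 1`). -/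
def bR (hM : m₁ + m₂ + 1 = M) : Fin (m₂ + 1) ↪ Fin (M + 1) :=
  ⟨fun j => ⟨m₁ + 1 + j.val, by have := j.isLt; omega⟩, fun i j h => Fin.ext (by have := congrArg Fin.val h; simp at this; omega)⟩

/-- Values of the left block embedding. -/
@[simp] theorem bL_val (hM : m₁ + m₂ + 1 = M) (i : Fin (m₁ + 1)) : (bL hM i).val = i.val := rfl

/-- Values of the right block embedding. -/
@[simp] theorem bR_val (hM : m₁ + m₂ + 1 = M) (j : Fin (m₂ + 1)) : (bR hM j).val = m₁ + 1 + j.val := rfl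

/-- The two blocks are disjoint. -/
theorem bL_ne_bR (hM : m₁ + m₂ + 1 = M) (i : Fin (m₁ + 1)) (j : Fin (m₂ + 1)) : bL hM i ≠ bR hM j := by
  intro h
  have := congrArg Fin.val h
  simp at this
  omega

/-- A function on `Fin (M+1)` GIVEN BLOCKWISE. -/
def blockFun {α : Type} (hM : m₁ + m₂ + 1 = M) (f₁ : Fin (m₁ + 1) → α) (f₂ : Fin (m₂ + 1) → α) (l : Fin (M + 1)) : α :=
  if h : l.val < m₁ + 1 then f₁ ⟨l.val, h⟩ else f₂ ⟨l.val - (m₁ + 1), by have := l.isLt; omega⟩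

/-- A blockwise function on the left block. -/
@[simp] theorem blockFun_bL {α : Type} (hM : m₁ + m₂ + 1 = M) (f₁ : Fin (m₁ + 1) → α) (f₂ : Fin (m₂ + 1) → α) (i : Fin (m₁ + 1)) :
    blockFun hM f₁ f₂ (bL hM i) = f₁ i := by
  unfold blockFun
  rw [dif_pos (show (bL hM i).val < m₁ + 1 from i.isLt)]
  rfl

/-- A blockwise function on the right block. -/
@[simp] theorem blockFun_bR {α : Type} (hM : m₁ + m₂ + 1 = M) (f₁ : Fin (m₁ + 1) → α) (f₂ : Fin (m₂ + 1) → α) (j : Fin (m₂ + 1)) :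
    blockFun hM f₁ f₂ (bR hM j) = f₂ j := by
  unfold blockFun
  rw [dif_neg (by simp [bR]; omega)]
  congr 1
  ext
  simp [bR]

/-- The two blocks exhaust `Fin (M+1)`: the block decomposition as an equivalence `Fin (m₁+1) ⊕ Fin (m₂+1) ≃ Fin (M+1)`. -/
def blockEquiv (hM : m₁ + m₂ + 1 = M) : Fin (m₁ + 1) ⊕ Fin (m₂ + 1) ≃ Fin (M + 1) where
  toFun := Sum.elim (bL hM) (bR hM)
  invFun := blockFun hM Sum.inl Sum.inr
  left_inv x := by rcases x with i | j <;> simp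
  right_inv l := by
    by_cases h : l.val < m₁ + 1
    · simp only [blockFun, dif_pos h, Sum.elim_inl]
      ext; simp [bL]
    · simp only [blockFun, dif_neg h, Sum.elim_inr]
      ext; simp [bR]; omega

/-- The block equivalence on the left summand. -/
@[simp] theorem blockEquiv_inl (hM : m₁ + m₂ + 1 = M) (i : Fin (m₁ + 1)) : blockEquiv hM (Sum.inl i) = bL hM i := rfl
/-- The block equivalence on the right summand. -/
@[simp] theorem blockEquiv_inr (hM : m₁ + m₂ + 1 = M) (j : Fin (m₂ + 1)) : blockEquiv hM (Sum.inr j) = bR hM j := rfl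

/-- Case analysis on an index of `Fin (M+1)`: it is in the left or in the right block. -/
theorem block_cases (hM : m₁ + m₂ + 1 = M) (l : Fin (M + 1)) : (∃ i, l = bL hM i) ∨ (∃ j, l = bR hM j) := by
  obtain ⟨x, rfl⟩ := (blockEquiv hM).surjective l
  rcases x with i | j
  · exact Or.inl ⟨i, rfl⟩
  · exact Or.inr ⟨j, rfl⟩

/-- A product over `Fin (M+1)` splits along the blocks. -/
theorem prod_block {R : Type} [CommMonoid R] (hM : m₁ + m₂ + 1 = M) (F : Fin (M + 1) → R) :
    ∏ l, F l = (∏ i, F (bL hM i)) * ∏ j, F (bR hM j) := by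
  rw [← Fintype.prod_equiv (blockEquiv hM) (fun x => F (blockEquiv hM x)) F (fun _ => rfl), Fintype.prod_sum_type]
  rfl


/-! ### Shifted blocks at the chart level (`M + 2` variables: `s = X 0`, `y_l = X l.succ`) -/

/-- The block identity one level up (chart variables). -/
theorem succ_hM (hM : m₁ + m₂ + 1 = M) : m₁ + 1 + m₂ + 1 = M + 1 := by omega

/-- The swapped block identity. -/
theorem swap_hM (hM : m₁ + m₂ + 1 = M) : m₂ + m₁ + 1 = M := by omega

/-- The left block embedding fixes `0` (`s ↦ s` one level up). -/
@[simp] theorem bL_zero (hM : m₁ + m₂ + 1 = M) : bL hM 0 = 0 := Fin.ext rfl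

/-- One level up, `y_i ↦ y_i` on the left block. -/
theorem bL_succ (hM : m₁ + m₂ + 1 = M) (i : Fin (m₁ + 1)) : bL (succ_hM hM) i.succ = (bL hM i).succ := Fin.ext (by simp)

/-- One level up, `y_j ↦ y_{m₁+1+j}` on the right block. -/
theorem bR_succ (hM : m₁ + m₂ + 1 = M) (j : Fin (m₂ + 1)) : bR (succ_hM hM) j = (bR hM j).succ := Fin.ext (by simp; omega)

/-- Values of `Fin.predAbove`. -/
theorem val_predAbove {n : ℕ} (p : Fin n) (i : Fin (n + 1)) :
    (p.predAbove i).val = if p.val < i.val then i.val - 1 else i.val := by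
  by_cases h : Fin.castSucc p < i
  · rw [Fin.predAbove_of_castSucc_lt _ _ h, Fin.val_pred, if_pos (by simpa [Fin.lt_def] using h)]
  · rw [Fin.predAbove_of_le_castSucc _ _ (not_lt.mp h), Fin.coe_castPred, if_neg (by simpa [Fin.lt_def] using h)]

/-- `predAbove` commutes with the left block. -/
theorem predAbove_bL (hM : m₁ + m₂ + 1 = M) (i₁ : Fin (m₁ + 1)) (t : Fin (m₁ + 1 + 1)) :
    Fin.predAbove (bL hM i₁) (bL (succ_hM hM) t) = bL hM (Fin.predAbove i₁ t) := by
  ext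
  simp only [val_predAbove, bL_val]

/-- `predAbove` at a left slot lowers the shifted right block back to the right block. -/
theorem predAbove_bL_bR (hM : m₁ + m₂ + 1 = M) (i₁ : Fin (m₁ + 1)) (j : Fin (m₂ + 1)) :
    Fin.predAbove (bL hM i₁) (bR (succ_hM hM) j) = bR hM j := by
  ext
  simp only [val_predAbove, bL_val, bR_val]
  have := i₁.isLt
  rw [if_pos (by omega)]
  omega

/-! ### Linear coefficients of renamed series -/

/-- The linear coefficient of `rename e p` at a variable in the range of `e`. -/
theorem coeff_single_rename_self {σ τ : Type} [Finite σ] (e : σ ↪ τ) (p : MvPowerSeries σ k) (i : σ) :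
    coeff (Finsupp.single (e i) 1) (rename e p) = coeff (Finsupp.single i 1) p := by
  rw [← Finsupp.embDomain_single, coeff_embDomain_rename]

/-- The linear coefficient of `rename e p` at a variable outside the range of `e` vanishes. -/
theorem coeff_single_rename_of_not_mem {σ τ : Type} [Finite σ] (e : σ ↪ τ) (p : MvPowerSeries σ k) {t : τ}
    (ht : t ∉ Set.range e) : coeff (Finsupp.single t 1) (rename e p) = 0 := by
  classical
  apply coeff_rename_eq_zero
  rintro ⟨x, hx⟩
  apply ht
  have hmem : t ∈ (Finsupp.mapDomain e x).support := by
    simp [hx]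
  obtain ⟨a, -, ha⟩ := Finset.mem_image.mp (Finsupp.mapDomain_support hmem)
  exact ⟨a, ha⟩

/-! ### Block extension of substitutions -/

variable (hM : m₁ + m₂ + 1 = M)

/-- BLOCK EXTENSION `Φ₁ ⊗ Φ₂` of two substitutions: `Φ₁` on the left block, `Φ₂` on the right block. -/
def blockSubst (Φ₁ : Fin (m₁ + 1) → MvPowerSeries (Fin (m₁ + 1)) k) (Φ₂ : Fin (m₂ + 1) → MvPowerSeries (Fin (m₂ + 1)) k) :
    Fin (M + 1) → MvPowerSeries (Fin (M + 1)) k :=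
  blockFun hM (fun i => rename (bL hM) (Φ₁ i)) (fun j => rename (bR hM) (Φ₂ j))

variable (Φ₁ : Fin (m₁ + 1) → MvPowerSeries (Fin (m₁ + 1)) k) (Φ₂ : Fin (m₂ + 1) → MvPowerSeries (Fin (m₂ + 1)) k)

/-- The block extension on the left block. -/
@[simp] theorem blockSubst_bL (i : Fin (m₁ + 1)) : blockSubst hM Φ₁ Φ₂ (bL hM i) = rename (bL hM) (Φ₁ i) :=
  blockFun_bL hM _ _ i

/-- The block extension on the right block. -/
@[simp] theorem blockSubst_bR (j : Fin (m₂ + 1)) : blockSubst hM Φ₁ Φ₂ (bR hM j) = rename (bR hM) (Φ₂ j) :=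
  blockFun_bR hM _ _ j

variable {Φ₁ Φ₂}

/-- The block extension has zero constant terms. -/
theorem constantCoeff_blockSubst (hΦ₁ : ∀ i, constantCoeff (Φ₁ i) = 0) (hΦ₂ : ∀ j, constantCoeff (Φ₂ j) = 0) (l : Fin (M + 1)) :
    constantCoeff (blockSubst hM Φ₁ Φ₂ l) = 0 := by
  rcases block_cases hM l with ⟨i, rfl⟩ | ⟨j, rfl⟩
  · rw [blockSubst_bL, constantCoeff_rename, hΦ₁]
  · rw [blockSubst_bR, constantCoeff_rename, hΦ₂]

/-- The block extension is substitutable. -/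
theorem hasSubst_blockSubst (hΦ₁ : ∀ i, constantCoeff (Φ₁ i) = 0) (hΦ₂ : ∀ j, constantCoeff (Φ₂ j) = 0) :
    HasSubst (blockSubst hM Φ₁ Φ₂) :=
  hasSubst_of_constantCoeff_zero (constantCoeff_blockSubst hM hΦ₁ hΦ₂)

variable (Φ₁ Φ₂) in
/-- The linear part of the block extension is block diagonal. -/
theorem linMat_blockSubst :
    (Matrix.of fun l j => coeff (Finsupp.single j 1) (blockSubst hM Φ₁ Φ₂ l)) =
      Matrix.reindex (blockEquiv hM) (blockEquiv hM)
        (Matrix.fromBlocks (Matrix.of fun i j => coeff (Finsupp.single j 1) (Φ₁ i)) 0 0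
          (Matrix.of fun i j => coeff (Finsupp.single j 1) (Φ₂ i))) := by
  ext l l'
  obtain ⟨x, rfl⟩ := (blockEquiv hM).surjective l
  obtain ⟨y, rfl⟩ := (blockEquiv hM).surjective l'
  rw [Matrix.reindex_apply, Matrix.submatrix_apply, Equiv.symm_apply_apply, Equiv.symm_apply_apply, Matrix.of_apply]
  rcases x with i | j <;> rcases y with i' | j'
  · rw [blockEquiv_inl, blockEquiv_inl, blockSubst_bL, Matrix.fromBlocks_apply₁₁, Matrix.of_apply, coeff_single_rename_self]
  · rw [blockEquiv_inl, blockEquiv_inr, blockSubst_bL, Matrix.fromBlocks_apply₁₂, Matrix.zero_apply,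
      coeff_single_rename_of_not_mem _ _ (fun ⟨i', h⟩ => bL_ne_bR hM i' j' h)]
  · rw [blockEquiv_inr, blockEquiv_inl, blockSubst_bR, Matrix.fromBlocks_apply₂₁, Matrix.zero_apply,
      coeff_single_rename_of_not_mem _ _ (fun ⟨j', h⟩ => bL_ne_bR hM i' j' h.symm)]
  · rw [blockEquiv_inr, blockEquiv_inr, blockSubst_bR, Matrix.fromBlocks_apply₂₂, Matrix.of_apply, coeff_single_rename_self]

variable (Φ₁ Φ₂) in
/-- Its determinant is the product of the blocks' determinants. -/
theorem det_linMat_blockSubst :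
    Matrix.det (Matrix.of fun l j => coeff (Finsupp.single j 1) (blockSubst hM Φ₁ Φ₂ l)) =
      Matrix.det (Matrix.of fun i j => coeff (Finsupp.single j 1) (Φ₁ i)) *
        Matrix.det (Matrix.of fun i j => coeff (Finsupp.single j 1) (Φ₂ i)) := by
  rw [linMat_blockSubst, Matrix.det_reindex_self, Matrix.det_fromBlocks_zero₂₁]

/-- TRANSFORM OF A LEFT-BLOCK SERIES under the block extension: `(Φ₁ ⊗ Φ₂)^*(b₁ on the left block) = (Φ₁^* b₁) on the left block`. -/
theorem subst_blockSubst_rename_bL (hΦ₁ : ∀ i, constantCoeff (Φ₁ i) = 0) (hΦ₂ : ∀ j, constantCoeff (Φ₂ j) = 0)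
    (b : MvPowerSeries (Fin (m₁ + 1)) k) :
    subst (blockSubst hM Φ₁ Φ₂) (rename (bL hM) b) = rename (bL hM) (subst Φ₁ b) := by
  rw [subst_rename_eq _ (hasSubst_blockSubst hM hΦ₁ hΦ₂), rename_subst_eq _ (hasSubst_of_constantCoeff_zero hΦ₁)]
  congr 1
  funext i
  exact blockSubst_bL hM Φ₁ Φ₂ i

/-- TRANSFORM OF A RIGHT-BLOCK SERIES under the block extension. -/
theorem subst_blockSubst_rename_bR (hΦ₁ : ∀ i, constantCoeff (Φ₁ i) = 0) (hΦ₂ : ∀ j, constantCoeff (Φ₂ j) = 0)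
    (b : MvPowerSeries (Fin (m₂ + 1)) k) :
    subst (blockSubst hM Φ₁ Φ₂) (rename (bR hM) b) = rename (bR hM) (subst Φ₂ b) := by
  rw [subst_rename_eq _ (hasSubst_blockSubst hM hΦ₁ hΦ₂), rename_subst_eq _ (hasSubst_of_constantCoeff_zero hΦ₂)]
  congr 1
  funext j
  exact blockSubst_bR hM Φ₁ Φ₂ j

/-! ### The cobordant chart with weights supported on the left block -/

/-- TRANSFORM OF A LEFT-BLOCK SERIES under a chart whose weights and exceptional point restrict to `(w₁, c₁)` on the left block:
it is the left chart's transform, placed on the shifted left block `(s, y_0, …, y_{m₁})`. -/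
theorem subst_chart_rename_bL {w : Fin (M + 1) → ℕ} {c : Fin (M + 1) → k} (hc : ∀ l, w l = 0 → c l = 0)
    {w₁ : Fin (m₁ + 1) → ℕ} {c₁ : Fin (m₁ + 1) → k} (hw : ∀ i, w (bL hM i) = w₁ i) (hcc : ∀ i, c (bL hM i) = c₁ i)
    (F : MvPowerSeries (Fin (m₁ + 1)) k) :
    subst (CobordantChart.chart w c) (rename (bL hM) F) =
      rename (bL (succ_hM hM)) (subst (CobordantChart.chart w₁ c₁) F) := by
  have hc₁ : ∀ i, w₁ i = 0 → c₁ i = 0 := fun i hi => by rw [← hcc]; exact hc _ (by rw [hw, hi])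
  rw [subst_rename_eq _ (CobordantChart.hasSubst_chart w c hc), rename_subst_eq _ (CobordantChart.hasSubst_chart w₁ c₁ hc₁)]
  congr 1
  funext i
  rw [Function.comp_apply, CobordantChart.chart_apply, CobordantChart.chart_apply, map_mul, map_pow, map_add, rename_X, rename_C,
    rename_X, hw, hcc, bL_zero, bL_succ]

/-- TRANSFORM OF A RIGHT-BLOCK SERIES under a chart with weight `0` on the right block: the series is re-indexed onto the shifted right
block `y_{m₁+1}, …` and otherwise unchanged. -/
theorem subst_chart_rename_bR {w : Fin (M + 1) → ℕ} {c : Fin (M + 1) → k} (hc : ∀ l, w l = 0 → c l = 0)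
    (hw : ∀ j, w (bR hM j) = 0) (b : MvPowerSeries (Fin (m₂ + 1)) k) :
    subst (CobordantChart.chart w c) (rename (bR hM) b) = rename (bR (succ_hM hM)) b := by
  rw [subst_rename_eq _ (CobordantChart.hasSubst_chart w c hc), rename_eq_subst]
  congr 1
  funext j
  rw [Function.comp_apply, Function.comp_apply, CobordantChart.chart_apply, hw, pow_zero, one_mul, hc _ (hw j), map_zero, zero_add,
    bR_succ]

/-! ### Slices at a left slot -/

/-- THE SLICE AT A LEFT SLOT of a shifted-left-block series is the left slice, placed on the left block (the INDEX FACT: after a left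
round the blocks stay contiguous). -/
theorem slice_bL_rename_bL (i₁ : Fin (m₁ + 1)) (H : MvPowerSeries (Fin (m₁ + 1 + 1)) k) :
    TupleGame.slice (bL hM i₁) (rename (bL (succ_hM hM)) H) = rename (bL hM) (TupleGame.slice i₁ H) := by
  unfold TupleGame.slice
  rw [subst_rename_eq _ (CobordantChartPlaneSlice.hasSubst_slice _), rename_subst_eq _ (CobordantChartPlaneSlice.hasSubst_slice _)]
  congr 1
  funext t
  rw [Function.comp_apply]
  by_cases ht : t = i₁.succ
  · subst ht
    rw [if_pos (bL_succ hM i₁), if_pos rfl, map_zero]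
  · have hne : bL (succ_hM hM) t ≠ (bL hM i₁).succ := fun h => ht (by
      rw [← bL_succ] at h
      exact (bL (succ_hM hM)).injective h)
    rw [if_neg hne, if_neg ht, rename_X, predAbove_bL]

/-- THE SLICE AT A LEFT SLOT of a shifted-right-block series is the series on the right block. -/
theorem slice_bL_rename_bR (i₁ : Fin (m₁ + 1)) (b : MvPowerSeries (Fin (m₂ + 1)) k) :
    TupleGame.slice (bL hM i₁) (rename (bR (succ_hM hM)) b) = rename (bR hM) b := by
  unfold TupleGame.slice
  rw [subst_rename_eq _ (CobordantChartPlaneSlice.hasSubst_slice _), rename_eq_subst]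
  congr 1
  funext j
  rw [Function.comp_apply, Function.comp_apply]
  have hne : bR (succ_hM hM) j ≠ (bL hM i₁).succ := fun h => by
    have h' := congrArg Fin.val h
    simp at h'
    have := i₁.isLt
    omega
  rw [if_neg hne, predAbove_bL_bR]

/-! ### `s`-divisibility on the blocks -/

/-- `s` stays `s` on the shifted left block. -/
theorem rename_bL_X_zero : rename (bL (succ_hM hM)) (X 0 : MvPowerSeries (Fin (m₁ + 1 + 1)) k) = X 0 := by
  rw [rename_X, bL_zero]

/-- `s ∣ (H on the shifted left block) → s ∣ H` (kill the complementary variables). -/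
theorem X_dvd_of_X_dvd_rename_bL {H : MvPowerSeries (Fin (m₁ + 1 + 1)) k} (h : X 0 ∣ rename (bL (succ_hM hM)) H) :
    (X 0 : MvPowerSeries (Fin (m₁ + 1 + 1)) k) ∣ H := by
  obtain ⟨q, hq⟩ := h
  have h' := congrArg (killCompl (bL (succ_hM hM))) hq
  rw [killCompl_rename_app, map_mul, ← bL_zero (succ_hM hM), killCompl_X] at h'
  exact ⟨_, h'⟩

/-- A series on the shifted right block involves no `s`: if `s` divides it, it is `0`. -/
theorem eq_zero_of_X_dvd_rename_bR {b : MvPowerSeries (Fin (m₂ + 1)) k} (h : X 0 ∣ rename (bR (succ_hM hM)) b) : b = 0 := by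
  obtain ⟨q, hq⟩ := h
  have h' := congrArg (killCompl (bR (succ_hM hM))) hq
  have h0 : (0 : Fin (M + 1 + 1)) ∉ Set.range (bR (succ_hM hM)) := by
    rintro ⟨j, hj⟩
    have := congrArg Fin.val hj
    simp at this
  rw [killCompl_rename_app, map_mul, killCompl_X_eq_zero h0, zero_mul] at h'
  exact h'

/-- Renaming along a block kills no non-zero series. -/
theorem rename_ne_zero {σ τ : Type} [Finite σ] (e : σ ↪ τ) {b : MvPowerSeries σ k} (hb : b ≠ 0) : rename e b ≠ 0 :=
  fun h => hb (rename_injective e (by rw [h, map_zero]))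



/-! ### The block swap -/

/-- The inverse block equivalence on the left block. -/
@[simp] theorem blockEquiv_symm_bL (i : Fin (m₁ + 1)) : (blockEquiv hM).symm (bL hM i) = Sum.inl i :=
  (blockEquiv hM).symm_apply_eq.mpr rfl

/-- The inverse block equivalence on the right block. -/
@[simp] theorem blockEquiv_symm_bR (j : Fin (m₂ + 1)) : (blockEquiv hM).symm (bR hM j) = Sum.inr j :=
  (blockEquiv hM).symm_apply_eq.mpr rfl

/-- THE BLOCK SWAP: the permutation of `Fin (M+1)` exchanging the left block (`m₁ + 1` variables) with the right block (`m₂ + 1`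
variables); afterwards the old right block is the left block of the swapped decomposition `M = m₂ + m₁ + 1`. -/
def blockSwap : Equiv.Perm (Fin (M + 1)) :=
  (blockEquiv hM).symm.trans ((Equiv.sumComm _ _).trans (blockEquiv (swap_hM hM)))

/-- The block swap sends the left block onto the right block of the swapped decomposition. -/
theorem blockSwap_bL (i : Fin (m₁ + 1)) : blockSwap hM (bL hM i) = bR (swap_hM hM) i := by
  simp [blockSwap]

/-- The block swap sends the right block onto the left block of the swapped decomposition. -/
theorem blockSwap_bR (j : Fin (m₂ + 1)) : blockSwap hM (bR hM j) = bL (swap_hM hM) j := by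
  simp [blockSwap]



/-- The block swap carries the left block onto the right block of the swapped decomposition … -/
theorem blockSwap_comp_bL : (⇑(blockSwap hM)) ∘ ⇑(bL hM) = ⇑(bR (swap_hM hM)) := funext (blockSwap_bL hM)

/-- … and the right block onto the left block of the swapped decomposition. -/
theorem blockSwap_comp_bR : (⇑(blockSwap hM)) ∘ ⇑(bR hM) = ⇑(bL (swap_hM hM)) := funext (blockSwap_bR hM)

end Blocks

end NCTransport

end Summit.ResolutionOfSingularities.ResolutionOfSingularities.Theorems
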